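import Summits.HubbardSuperconductivity.HubbardSuperconductivity.Theorems.AnisotropyChordTransferFibre3N1RowObjJRed

/-!
# Route `AnisotropyChord` / H0 rotor rung, LEVEL 2 row `N₁`: the auto-generated OUTER `RExpr`s of `Ĵ₁` at the true vector

Soundness of part 4a (`…N1RowExprJA`, generated by bc_codegen.py): at the true vector `X = xTrue L Δ λ₂ f a` of a ground profile,
* ★ `eval_J1o0Full`, `eval_J1t1Full`, `eval_J1t2Full`, `eval_J1t4Full`, `eval_J1t5Full`: each FULL polynomial evaluates to
  `θ⁴·Σ_{T′}` of the true summand (`o0 = R(c+c′) + Mc′`, `t1, t2, t4, t5` = the four majorants of `OuterMaj.bc_outer_bound` with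
  `κ̂′`, `m₀ = 13/10`) — via the reduced pair polynomials of `…N1RowObjJRed` (`sum_torPrime_…`) and ONE `ring` identity each;
* ★ `eval_J1o0At`, …, `eval_J1t5At`: each AT-polynomial at a grid pair `(q, q + x̂)` evaluates to `θ⁴·`(true summand at `k = toTor q`).
Tools: `full_dictionary` (all coordinate/scalar identifications, `λ₂ = X₂θ²`, `ε₁ = X₁₆θ²`, `π² = θ²V/4`), `pair_dictionary`
(`ĝ, ĝ′`, `E = θ²Ê`), `serJ_one/two`.
Prover seat `hubbard-h0-rotor-p2` g5; helper for piece A = stmt-HubbardSuperconductivity-23918 of rung 19089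
(`--supports`, helper class).  Nothing here proves superconductivity in the Hubbard model; helper lemmas of ONE conditional
reduction (the GM₃ ∀L certificate, Level-2 row `N₁`); the rotor TARGET as originally worded stays FALSE (g15 verdict).
Mathlib + the tree only; no sorry.
-/

set_option linter.dupNamespace false
set_option autoImplicit false

open Literature.Analysis.ValidatedNumerics

namespace Summit.HubbardSuperconductivity.HubbardSuperconductivity.Theorems.AnisotropyChord.Transfer.Fibre3.L2.N1

variable (L : ℕ) [NeZero L] (Δ lam2 : ℝ) (f : Tor L → ℝ)

/-! ## Dictionaries -/

/-- explicit forms of `serJ 1`, `serJ 2`. -/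
theorem serJ_one : serJ L lam2 1 = 4 * (S1n L lam2 - gres L lam2 (K1 L) ^ 1)
    - 2 * (1 - eps1 L) * ((1 - lam2 / 4) * S1n L lam2 - ((L : ℝ) ^ 2 - 1) / 4 - gres L lam2 (K1 L) ^ 1 * (1 - eps1 L))
    + 2 * (2 * eps1 L - eps1 L ^ 2) * gres L lam2 (K1 L) ^ 1
    - 2 * ((1 - lam2 / 4) * S1n L lam2 - ((L : ℝ) ^ 2 - 1) / 4 - gres L lam2 (K1 L) ^ 1) := by
  unfold serJ; simp

/-- explicit form of `serJ 2`. -/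
theorem serJ_two : serJ L lam2 2 = 4 * (S2n L lam2 - gres L lam2 (K1 L) ^ 2)
    - 2 * (1 - eps1 L) * ((1 - lam2 / 4) * S2n L lam2 - S1n L lam2 / 4 - gres L lam2 (K1 L) ^ 2 * (1 - eps1 L))
    + 2 * (2 * eps1 L - eps1 L ^ 2) * gres L lam2 (K1 L) ^ 2
    - 2 * ((1 - lam2 / 4) * S2n L lam2 - S1n L lam2 / 4 - gres L lam2 (K1 L) ^ 2) := by
  unfold serJ; simp

/-- ★ all scalar / coordinate identifications at the true vector used by the outer identities. -/
theorem full_dictionary (hL : 12 ≤ L) (hΔ0 : 0 ≤ Δ) (hΔ1 : Δ < 1) (hf : IsGroundTwoMagnon L Δ lam2 f) (hlam : 0 < lam2)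
    (h2 : 2 * lam2 < eps1 L) (hu : 0 < cS L Δ lam2 f * Gzero L lam2) (X : ℕ → ℝ) (hX : X = xTrue L Δ lam2 f (Δ * f (K1 L))) :
    cs.eval X = cS L Δ lam2 f ∧ dd.eval X = dPar L Δ f ∧ qq.eval X = qPar L Δ f ∧ kap.eval X = kapP L Δ lam2 f ∧
    taubar.eval X = tauBar L Δ lam2 f ∧ S1h.eval X = (2 * Real.pi / L) ^ 2 * S1n L lam2 ∧
    (g1h 3).eval X = (2 * Real.pi / L) ^ 2 * gres L lam2 (K1 L) ∧
    X 0 = (2 * Real.pi / L) ^ 2 ∧ X 1 = Real.pi ^ 2 ∧ X 4 = (2 * Real.pi / L) ^ (2 * 2) * S2n L lam2 ∧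
    X 5 = (2 * Real.pi / L) ^ (2 * 3) * S3n L lam2 ∧ X 7 = (2 * Real.pi / L) ^ (2 * 2) * T10n L lam2 ∧
    X 9 = (2 * Real.pi / L) ^ (2 * 3) * G21n L lam2 ∧ X 10 = (2 * Real.pi / L) ^ (2 * 3) * G12n L lam2 ∧
    lam2 = X 2 * (2 * Real.pi / L) ^ 2 ∧ eps1 L = X 16 * (2 * Real.pi / L) ^ 2 ∧
    Real.pi ^ 2 = (2 * Real.pi / L) ^ 2 * (L : ℝ) ^ 2 / 4 := by
  subst hX
  obtain ⟨_, dcs, _, ddd, _⟩ := dict_at_xTrue L Δ lam2 f (by omega) hΔ0 hΔ1 hf hlam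
  have hLpos : (0 : ℝ) < L := by exact_mod_cast (show 0 < L by omega)
  have hθ2 : (2 * Real.pi / (L : ℝ)) ^ 2 ≠ 0 := by positivity
  refine ⟨dcs, by rw [ddd]; rfl, eval_qq L Δ lam2 f (by omega) hΔ0 hΔ1 hf, ?_, eval_taubar L Δ lam2 f (by omega) hΔ0 hΔ1 hf hlam,
    S1h_eval L Δ lam2 f (by omega) hΔ0 hΔ1 hf hlam hu, eval_g1h L Δ lam2 f _, xTrue_zero L Δ lam2 f _, ?_, ?_, ?_, ?_, ?_, ?_,
    ?_, ?_, ?_⟩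
  · rw [kap_eval L Δ lam2 f hL hΔ0 hΔ1 hf hlam h2 hu]; rfl
  · rw [xTrue_lt16 L Δ lam2 f _ (by norm_num)]; rfl
  · rw [xTrue_lt16 L Δ lam2 f _ (by norm_num)]; rfl
  · rw [xTrue_lt16 L Δ lam2 f _ (by norm_num)]; rfl
  · rw [xTrue_lt16 L Δ lam2 f _ (by norm_num)]; rfl
  · rw [xTrue_lt16 L Δ lam2 f _ (by norm_num)]; rfl
  · rw [xTrue_lt16 L Δ lam2 f _ (by norm_num)]; rfl
  · rw [xTrue_lt16 L Δ lam2 f _ (by norm_num)]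
    show lam2 = lam2 / (2 * Real.pi / L) ^ 2 * (2 * Real.pi / L) ^ 2
    field_simp
  · rw [xTrue_16]; unfold eps1; field_simp
  · field_simp; ring

/-- the pair coordinates: `ĝ, ĝ′` and `E = θ²Ê`, `E′ = θ²Ê′` at a grid pair. -/
theorem pair_dictionary (hL : 12 ≤ L) (hlam : 0 < lam2) (h2 : 2 * lam2 < eps1 L) {q : ℤ × ℤ} (hq : q ∈ gridPts 3)
    (hq' : (q.1 + 1, q.2) ∈ gridPts 3) (X : ℕ → ℝ) (hX : X = xTrue L Δ lam2 f (Δ * f (K1 L))) :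
    (vG 3 q).eval X = (2 * Real.pi / L) ^ 2 * gres L lam2 (B1.toTor L q) ∧
    (vG 3 (q.1 + 1, q.2)).eval X = (2 * Real.pi / L) ^ 2 * gres L lam2 (B1.toTor L q + K1 L) ∧
    2 * epsT L (B1.toTor L q) = (2 * Real.pi / L) ^ 2 * (Eh 3 q).eval X ∧
    2 * epsT L (B1.toTor L q + K1 L) = (2 * Real.pi / L) ^ 2 * (Eh 3 (q.1 + 1, q.2)).eval X := by
  subst hX
  have hLpos : (0 : ℝ) < L := by exact_mod_cast (show 0 < L by omega)
  have hθ2 : (2 * Real.pi / (L : ℝ)) ^ 2 ≠ 0 := by positivity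
  refine ⟨eval_vG L Δ lam2 f hq _, by rw [eval_vG L Δ lam2 f hq' _, toTor_shift], ?_, ?_⟩
  · rw [eval_Eh L Δ lam2 f (by omega) hlam h2 hq]; field_simp
  · rw [eval_Eh L Δ lam2 f (by omega) hlam h2 hq', toTor_shift]; field_simp

/-- `G12 = G21` (reflection `k ↦ −k − K₁`, `g` even). -/
theorem G12n_eq_G21n : G12n L lam2 = G21n L lam2 := by
  rw [ClosedExp.G12n_eq, ClosedExp.G21n_eq]
  refine Fintype.sum_equiv ((Equiv.neg (Tor L)).trans (Equiv.subRight (K1 L))) _ _ fun k => ?_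
  simp only [Equiv.trans_apply, Equiv.neg_apply, Equiv.subRight_apply]
  rw [show -k - K1 L + K1 L = -k by ring, show -k - K1 L = -(k + K1 L) by ring, B1.gres_neg, B1.gres_neg]
  ring

/-! ## The FULL polynomials -/

/-- ★ `J1o0Full ↦ θ⁴·Σ_{T′} o0` (the auto-generated full sum of part 4a equals the reduced pair polynomial's named value). -/
theorem eval_J1o0Full (hL : 12 ≤ L) (hΔ0 : 0 ≤ Δ) (hΔ1 : Δ < 1) (hf : IsGroundTwoMagnon L Δ lam2 f) (hlam : 0 < lam2)
    (h2 : 2 * lam2 < eps1 L) (hu : 0 < cS L Δ lam2 f * Gzero L lam2) :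
    (J1o0Full 3).eval (xTrue L Δ lam2 f (Δ * f (K1 L)))
      = ((2 * Real.pi / L) ^ 2) ^ 2 * ∑ k ∈ torPrime L, (RK L Δ lam2 f k * (cK L Δ lam2 f k + cK L Δ lam2 f (k + K1 L)) + MK L Δ lam2 f k * cK L Δ lam2 f (k + K1 L)) := by
  rw [sum_torPrime_o0 L Δ lam2 f hlam (by linarith)]
  set X := xTrue L Δ lam2 f (Δ * f (K1 L)) with hXdef
  obtain ⟨dcs, ddd, hqq, hkP, hτ, hS1, hg1, hX0, hX1, hX4, hX5, hX7, hX9, hX10, hlam', heps, hπ2⟩ :=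
    full_dictionary L Δ lam2 f hL hΔ0 hΔ1 hf hlam h2 hu X hXdef
  simp only [J1o0Full, rsum, cube, RExpr.eval, cst, vT, vPi2, vS2, vT10, vG21, vG12, vNu, vE1]
  push_cast
  rw [dcs, ddd, hqq, hS1, hg1, hX0, hX1, hX4, hX7, hX9, hX10]
  unfold PairCoef.red pcO0
  dsimp only
  rw [serJ_one, serJ_two, hπ2, heps, hlam']
  ring

/-- ★ `J1t1Full ↦ θ⁴·Σ_{T′} t1` (the auto-generated full sum of part 4a equals the reduced pair polynomial's named value). -/
theorem eval_J1t1Full (hL : 12 ≤ L) (hΔ0 : 0 ≤ Δ) (hΔ1 : Δ < 1) (hf : IsGroundTwoMagnon L Δ lam2 f) (hlam : 0 < lam2)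
    (h2 : 2 * lam2 < eps1 L) (hu : 0 < cS L Δ lam2 f * Gzero L lam2) :
    (J1t1Full 3).eval (xTrue L Δ lam2 f (Δ * f (K1 L)))
      = ((2 * Real.pi / L) ^ 2) ^ 2 * ∑ k ∈ torPrime L, (jRabs L Δ lam2 f k * kapP L Δ lam2 f * (gres L lam2 k + gres L lam2 (k + K1 L))) := by
  rw [sum_torPrime_t1 L Δ lam2 f hlam (by linarith)]
  set X := xTrue L Δ lam2 f (Δ * f (K1 L)) with hXdef
  obtain ⟨dcs, ddd, hqq, hkP, hτ, hS1, hg1, hX0, hX1, hX4, hX5, hX7, hX9, hX10, hlam', heps, hπ2⟩ :=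
    full_dictionary L Δ lam2 f hL hΔ0 hΔ1 hf hlam h2 hu X hXdef
  simp only [J1t1Full, rsum, cube, RExpr.eval, cst, vT, vPi2, vS2, vT10, vG21, vG12, vNu, vE1]
  push_cast
  rw [dcs, ddd, hqq, hkP, hS1, hg1, hX0, hX1, hX4, hX7, hX9, hX10]
  unfold PairCoef.red pcT1
  dsimp only
  rw [serJ_one, serJ_two, hπ2, heps, hlam']
  ring

/-- ★ `J1t2Full ↦ θ⁴·Σ_{T′} t2` (the auto-generated full sum of part 4a equals the reduced pair polynomial's named value;
the largest identity, 113 monomials; uses `G12 = G21`). -/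
theorem eval_J1t2Full (hL : 12 ≤ L) (hΔ0 : 0 ≤ Δ) (hΔ1 : Δ < 1) (hf : IsGroundTwoMagnon L Δ lam2 f) (hlam : 0 < lam2)
    (h2 : 2 * lam2 < eps1 L) (hu : 0 < cS L Δ lam2 f * Gzero L lam2) :
    (J1t2Full 3).eval (xTrue L Δ lam2 f (Δ * f (K1 L)))
      = ((2 * Real.pi / L) ^ 2) ^ 2 * ∑ k ∈ torPrime L, (jD1 L Δ lam2 f k * jZ L Δ lam2 f k) := by
  rw [sum_torPrime_t2 L Δ lam2 f hlam (by linarith)]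
  set X := xTrue L Δ lam2 f (Δ * f (K1 L)) with hXdef
  obtain ⟨dcs, ddd, hqq, hkP, hτ, hS1, hg1, hX0, hX1, hX4, hX5, hX7, hX9, hX10, hlam', heps, hπ2⟩ :=
    full_dictionary L Δ lam2 f hL hΔ0 hΔ1 hf hlam h2 hu X hXdef
  simp only [J1t2Full, rsum, cube, RExpr.eval, cst, vT, vPi2, vS2, vS3, vT10, vG21, vG12, vNu, vE1]
  push_cast
  rw [dcs, ddd, hqq, hkP, hτ, hS1, hg1, hX0, hX1, hX4, hX5, hX7, hX9, hX10]
  unfold PairCoef.red pcT2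
  dsimp only
  rw [serJ_one, serJ_two, G12n_eq_G21n, hπ2, heps, hlam']
  ring

/-- ★ `J1t4Full ↦ θ⁴·Σ_{T′} t4` (the auto-generated full sum of part 4a equals the reduced pair polynomial's named value). -/
theorem eval_J1t4Full (hL : 12 ≤ L) (hΔ0 : 0 ≤ Δ) (hΔ1 : Δ < 1) (hf : IsGroundTwoMagnon L Δ lam2 f) (hlam : 0 < lam2)
    (h2 : 2 * lam2 < eps1 L) (hu : 0 < cS L Δ lam2 f * Gzero L lam2) :
    (J1t4Full 3).eval (xTrue L Δ lam2 f (Δ * f (K1 L)))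
      = ((2 * Real.pi / L) ^ 2) ^ 2 * ∑ k ∈ torPrime L, (MK L Δ lam2 f k * kapP L Δ lam2 f * gres L lam2 (k + K1 L)) := by
  rw [sum_torPrime_t4 L Δ lam2 f hlam (by linarith)]
  set X := xTrue L Δ lam2 f (Δ * f (K1 L)) with hXdef
  obtain ⟨dcs, ddd, hqq, hkP, hτ, hS1, hg1, hX0, hX1, hX4, hX5, hX7, hX9, hX10, hlam', heps, hπ2⟩ :=
    full_dictionary L Δ lam2 f hL hΔ0 hΔ1 hf hlam h2 hu X hXdef
  simp only [J1t4Full, rsum, cube, RExpr.eval, cst, vT, vPi2, vT10, vG21, vNu, vE1]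
  push_cast
  rw [dcs, ddd, hqq, hkP, hS1, hg1, hX0, hX1, hX7, hX9]
  unfold PairCoef.red pcT4
  dsimp only
  rw [serJ_one, serJ_two, hπ2, heps, hlam']
  ring

/-- ★ `J1t5Full ↦ θ⁴·Σ_{T′} t5` (the auto-generated full sum of part 4a equals the reduced pair polynomial's named value). -/
theorem eval_J1t5Full (hL : 12 ≤ L) (hΔ0 : 0 ≤ Δ) (hΔ1 : Δ < 1) (hf : IsGroundTwoMagnon L Δ lam2 f) (hlam : 0 < lam2)
    (h2 : 2 * lam2 < eps1 L) (hu : 0 < cS L Δ lam2 f * Gzero L lam2) :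
    (J1t5Full 3).eval (xTrue L Δ lam2 f (Δ * f (K1 L)))
      = ((2 * Real.pi / L) ^ 2) ^ 2 * ∑ k ∈ torPrime L, (YP2 L Δ lam2 f k * acZ L Δ lam2 f (k + K1 L)) := by
  rw [sum_torPrime_t5 L Δ lam2 f hlam (by linarith)]
  set X := xTrue L Δ lam2 f (Δ * f (K1 L)) with hXdef
  obtain ⟨dcs, ddd, hqq, hkP, hτ, hS1, hg1, hX0, hX1, hX4, hX5, hX7, hX9, hX10, hlam', heps, hπ2⟩ :=
    full_dictionary L Δ lam2 f hL hΔ0 hΔ1 hf hlam h2 hu X hXdef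
  simp only [J1t5Full, rsum, cube, RExpr.eval, cst, vT, vPi2, vS2, vT10, vG21, vNu, vE1]
  push_cast
  rw [dcs, ddd, hqq, hkP, hτ, hS1, hg1, hX0, hX1, hX4, hX7, hX9]
  unfold PairCoef.red pcT5
  dsimp only
  rw [serJ_one, serJ_two, hπ2, heps, hlam']
  ring

/-! ## The AT-pair polynomials -/

/-- ★ `J1o0At q ↦ θ⁴·(o0 summand at k = toTor q)` for a pair `(q, q + x̂)` of grid points. -/
theorem eval_J1o0At (hL : 12 ≤ L) (hΔ0 : 0 ≤ Δ) (hΔ1 : Δ < 1) (hf : IsGroundTwoMagnon L Δ lam2 f) (hlam : 0 < lam2)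
    (h2 : 2 * lam2 < eps1 L) (hu : 0 < cS L Δ lam2 f * Gzero L lam2) {q : ℤ × ℤ} (hq : q ∈ gridPts 3)
    (hq' : (q.1 + 1, q.2) ∈ gridPts 3) :
    let k := B1.toTor L q
    (J1o0At 3 q).eval (xTrue L Δ lam2 f (Δ * f (K1 L))) = ((2 * Real.pi / L) ^ 2) ^ 2 * (RK L Δ lam2 f k * (cK L Δ lam2 f k + cK L Δ lam2 f (k + K1 L)) + MK L Δ lam2 f k * cK L Δ lam2 f (k + K1 L)) := by
  intro k
  set X := xTrue L Δ lam2 f (Δ * f (K1 L)) with hXdef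
  obtain ⟨dcs, ddd, hqq, hkP, hτ, hS1, hg1, hX0, hX1, hX4, hX5, hX7, hX9, hX10, hlam', heps, hπ2⟩ :=
    full_dictionary L Δ lam2 f hL hΔ0 hΔ1 hf hlam h2 hu X hXdef
  obtain ⟨hG, hG', hEk, hEk'⟩ := pair_dictionary L Δ lam2 f hL hlam h2 hq hq' X hXdef
  simp only [J1o0At, rsum, cube, RExpr.eval, cst, vT, vE1]
  push_cast
  rw [dcs, ddd, hqq, hX0, hG, hG']
  unfold RK MK cK betaK EK
  rw [hEk, hEk', heps, hlam']
  ring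

/-- ★ `J1t1At q ↦ θ⁴·(t1 summand at k = toTor q)` for a pair `(q, q + x̂)` of grid points. -/
theorem eval_J1t1At (hL : 12 ≤ L) (hΔ0 : 0 ≤ Δ) (hΔ1 : Δ < 1) (hf : IsGroundTwoMagnon L Δ lam2 f) (hlam : 0 < lam2)
    (h2 : 2 * lam2 < eps1 L) (hu : 0 < cS L Δ lam2 f * Gzero L lam2) {q : ℤ × ℤ} (hq : q ∈ gridPts 3)
    (hq' : (q.1 + 1, q.2) ∈ gridPts 3) :
    let k := B1.toTor L q
    (J1t1At 3 q).eval (xTrue L Δ lam2 f (Δ * f (K1 L))) = ((2 * Real.pi / L) ^ 2) ^ 2 * (jRabs L Δ lam2 f k * kapP L Δ lam2 f * (gres L lam2 k + gres L lam2 (k + K1 L))) := by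
  intro k
  set X := xTrue L Δ lam2 f (Δ * f (K1 L)) with hXdef
  obtain ⟨dcs, ddd, hqq, hkP, hτ, hS1, hg1, hX0, hX1, hX4, hX5, hX7, hX9, hX10, hlam', heps, hπ2⟩ :=
    full_dictionary L Δ lam2 f hL hΔ0 hΔ1 hf hlam h2 hu X hXdef
  obtain ⟨hG, hG', hEk, hEk'⟩ := pair_dictionary L Δ lam2 f hL hlam h2 hq hq' X hXdef
  simp only [J1t1At, rsum, RExpr.eval, cst, vT, vE1]
  push_cast
  rw [dcs, ddd, hqq, hkP, hX0, hG, hG']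
  unfold jRabs betaK EK
  rw [hEk, hEk', heps, hlam']
  ring

/-- ★ `J1t2At q ↦ θ⁴·(t2 summand at k = toTor q)` for a pair `(q, q + x̂)` of grid points. -/
theorem eval_J1t2At (hL : 12 ≤ L) (hΔ0 : 0 ≤ Δ) (hΔ1 : Δ < 1) (hf : IsGroundTwoMagnon L Δ lam2 f) (hlam : 0 < lam2)
    (h2 : 2 * lam2 < eps1 L) (hu : 0 < cS L Δ lam2 f * Gzero L lam2) {q : ℤ × ℤ} (hq : q ∈ gridPts 3)
    (hq' : (q.1 + 1, q.2) ∈ gridPts 3) :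
    let k := B1.toTor L q
    (J1t2At 3 q).eval (xTrue L Δ lam2 f (Δ * f (K1 L))) = ((2 * Real.pi / L) ^ 2) ^ 2 * (jD1 L Δ lam2 f k * jZ L Δ lam2 f k) := by
  intro k
  set X := xTrue L Δ lam2 f (Δ * f (K1 L)) with hXdef
  obtain ⟨dcs, ddd, hqq, hkP, hτ, hS1, hg1, hX0, hX1, hX4, hX5, hX7, hX9, hX10, hlam', heps, hπ2⟩ :=
    full_dictionary L Δ lam2 f hL hΔ0 hΔ1 hf hlam h2 hu X hXdef
  obtain ⟨hG, hG', hEk, hEk'⟩ := pair_dictionary L Δ lam2 f hL hlam h2 hq hq' X hXdef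
  simp only [J1t2At, rsum, cube, RExpr.eval, cst, vT]
  push_cast
  rw [dcs, ddd, hqq, hkP, hτ, hX0, hG, hG']
  unfold jD1 jZ betaK EK
  dsimp only
  rw [hEk, hEk', hlam']
  ring

/-- ★ `J1t4At q ↦ θ⁴·(t4 summand at k = toTor q)` for a pair `(q, q + x̂)` of grid points. -/
theorem eval_J1t4At (hL : 12 ≤ L) (hΔ0 : 0 ≤ Δ) (hΔ1 : Δ < 1) (hf : IsGroundTwoMagnon L Δ lam2 f) (hlam : 0 < lam2)
    (h2 : 2 * lam2 < eps1 L) (hu : 0 < cS L Δ lam2 f * Gzero L lam2) {q : ℤ × ℤ} (hq : q ∈ gridPts 3)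
    (hq' : (q.1 + 1, q.2) ∈ gridPts 3) :
    let k := B1.toTor L q
    (J1t4At 3 q).eval (xTrue L Δ lam2 f (Δ * f (K1 L))) = ((2 * Real.pi / L) ^ 2) ^ 2 * (MK L Δ lam2 f k * kapP L Δ lam2 f * gres L lam2 (k + K1 L)) := by
  intro k
  set X := xTrue L Δ lam2 f (Δ * f (K1 L)) with hXdef
  obtain ⟨dcs, ddd, hqq, hkP, hτ, hS1, hg1, hX0, hX1, hX4, hX5, hX7, hX9, hX10, hlam', heps, hπ2⟩ :=
    full_dictionary L Δ lam2 f hL hΔ0 hΔ1 hf hlam h2 hu X hXdef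
  obtain ⟨hG, hG', hEk, hEk'⟩ := pair_dictionary L Δ lam2 f hL hlam h2 hq hq' X hXdef
  simp only [J1t4At, rsum, RExpr.eval, cst, vT]
  push_cast
  rw [dcs, ddd, hqq, hkP, hX0, hG, hG']
  unfold MK betaK EK
  rw [hEk, hlam']
  ring

/-- ★ `J1t5At q ↦ θ⁴·(t5 summand at k = toTor q)` for a pair `(q, q + x̂)` of grid points. -/
theorem eval_J1t5At (hL : 12 ≤ L) (hΔ0 : 0 ≤ Δ) (hΔ1 : Δ < 1) (hf : IsGroundTwoMagnon L Δ lam2 f) (hlam : 0 < lam2)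
    (h2 : 2 * lam2 < eps1 L) (hu : 0 < cS L Δ lam2 f * Gzero L lam2) {q : ℤ × ℤ} (hq : q ∈ gridPts 3)
    (hq' : (q.1 + 1, q.2) ∈ gridPts 3) :
    let k := B1.toTor L q
    (J1t5At 3 q).eval (xTrue L Δ lam2 f (Δ * f (K1 L))) = ((2 * Real.pi / L) ^ 2) ^ 2 * (YP2 L Δ lam2 f k * acZ L Δ lam2 f (k + K1 L)) := by
  intro k
  set X := xTrue L Δ lam2 f (Δ * f (K1 L)) with hXdef
  obtain ⟨dcs, ddd, hqq, hkP, hτ, hS1, hg1, hX0, hX1, hX4, hX5, hX7, hX9, hX10, hlam', heps, hπ2⟩ :=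
    full_dictionary L Δ lam2 f hL hΔ0 hΔ1 hf hlam h2 hu X hXdef
  obtain ⟨hG, hG', hEk, hEk'⟩ := pair_dictionary L Δ lam2 f hL hlam h2 hq hq' X hXdef
  simp only [J1t5At, rsum, cube, RExpr.eval, cst, vT]
  push_cast
  rw [dcs, ddd, hqq, hkP, hτ, hX0, hG, hG']
  unfold YP2 acZ betaK EK
  dsimp only
  rw [hEk, hlam']
  ring

end Summit.HubbardSuperconductivity.HubbardSuperconductivity.Theorems.AnisotropyChord.Transfer.Fibre3.L2.N1
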